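import Summits.AtomisticToContinuum.Crystallization.Theses.OneCrossingRisingSea

/-!
# Birth skeleton — crux `OneCrossingRisingSea.ClassOneEnergy`

Item `stmt-AtomisticToContinuum-12049` (crux, rank 3, route `OneCrossingRisingSea`, sub-problem
`Crystallization`). The crux is the CLASS-WIDE energetic form of crystallization: for every
class-1 pair potential `V` (one-crossing Gaussian mixture with divergent core, a negative value, a
summable tail `|V r| ≤ C r^-(3+ε)` for `r ≥ 1`, and stability in `ℝ³`),
`HasPeriodicGroundStateEnergy V 3`: the minimum of the energy per particle over periodic
configurations of `ℝ³` is ATTAINED at some `P` and `E(N)/N → e_V(P)`.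

First cut (three named stubs; the cut is the board's Lennard-Jones decomposition
0626 `CrysEnergyLimit` / 0627 `CrysPeriodicMinAttained` lifted to class 1, with the thermodynamic
limit split into its two mechanisms so that each provable-now piece is separately attackable):

* `stub_periodicTrialStateUpperBound` — crystal blocks as trial states: for every class-1 `V`,
  every periodic `Q` and every `ε > 0`, eventually `E(N)/N ≤ e_V(Q) + ε` (i.e.
  `limsup E(N)/N ≤ e_V(Q)`). TRUE and provable now (size M/L): the class-1 analogue of the
  in-tree Lennard-Jones trial-state bound (`ChargedEnergyGapNegative.le_energyPerParticle_of_tendsto`,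
  `exists_trialState`, blocks of `Q` with an `o(N)` boundary layer); needs only continuity of `V`
  on `(0, ∞)` (dominated convergence in the mixture representation), the tail bound and stability
  (`E(N)` is a genuine infimum).
* `stub_periodisationLowerBound` — periodisation of finite near-minimisers: for every class-1 `V`,
  every `N ≥ 1` and `ε > 0` there is a periodic `Q` with `e_V(Q) ≤ E(N)/N + ε`. TRUE and provable
  now (size M): repeat an `ε`-minimiser of `E(N)` with a large cubic period (class-1 analogue of
  `ChargedEnergyGapNegative.energyPerParticle_periodise_le`; cross-cell terms vanish by the tail
  bound, or are `≤ 0` outright since a one-crossing mixture with a negative value is eventually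
  non-positive: `s ↦ e^(t₀ s) V(√s)` is non-increasing).
* `stub_periodicMinimumAttained` — ATTAINMENT: for every class-1 `V` the infimum of `e_V` over
  periodic configurations of `ℝ³` is a minimum. This is the open heart of the crux (class-1
  analogue of the open shared item 0627): compactness of minimising sequences of periodic
  configurations modulo translation needs bounded complexity (no devil's staircase of optimal
  periods — the crux's own "why it might fail"), non-dilution (attractive tail) and non-collapse
  (divergent core + stability).

Assembly `ClassOneEnergy_of`: take the minimiser `P` of stub 3; `E(N)/N → e_V(P)` by a squeeze —
above by stub 1 at `Q = P`, below by stub 2 and `e_V(P) ≤ e_V(Q)` (`IsLeast`). Real proof, no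
`sorry`; concludes the route decl `OneCrossingRisingSea.ClassOneEnergy` BY NAME.
Sorries: exactly the three stubs.
-/

namespace Summit.AtomisticToContinuum.Crystallization.Cruxes.ClassOneEnergy.Birth

/-- **Stub 1 — periodic trial states bound the ground-state energy from above.** For every
class-1 potential `V`, every periodic configuration `Q` of `ℝ³` and every `ε > 0`:
`E(N)/N ≤ e_V(Q) + ε` for all large `N` (blocks of `Q` are `N`-point trial states whose energy is
`N e_V(Q) + o(N)` by absolute summability of the lattice sums and an `o(N)` boundary layer).
Strictly weaker than the crux; true; provable now (class-1 analogue of the Lennard-Jones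
trial-state bound in `Theorems/ChargedEnergyGap/Negative/`). -/
theorem stub_periodicTrialStateUpperBound : ∀ V : ℝ → ℝ, (Literature.MathematicalPhysics.StatisticalMechanics.IsOneCrossingMixture V ∧ Filter.Tendsto V (nhdsWithin 0 (Set.Ioi 0)) Filter.atTop ∧ (∃ r : ℝ, 0 < r ∧ V r < 0) ∧ (∃ C ε : ℝ, 0 < ε ∧ ∀ r : ℝ, 1 ≤ r → |V r| ≤ C * r ^ (-(3 + ε))) ∧ (∃ B : ℝ, ∀ (N : ℕ) (x : Fin N → EuclideanSpace ℝ (Fin 3)), Function.Injective x → -(B * (N : ℝ)) ≤ Literature.MathematicalPhysics.StatisticalMechanics.interactionEnergy V x)) → ∀ Q : Literature.MathematicalPhysics.StatisticalMechanics.PeriodicConfiguration 3, ∀ ε : ℝ, 0 < ε → ∃ N₀ : ℕ, ∀ N : ℕ, N₀ ≤ N → Literature.MathematicalPhysics.StatisticalMechanics.groundStateEnergy V 3 N / (N : ℝ) ≤ Q.energyPerParticle V + ε := by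
  sorry

/-- **Stub 2 — periodisation of finite near-minimisers.** For every class-1 potential `V`, every
`N ≥ 1` and every `ε > 0` there is a periodic configuration `Q` of `ℝ³` with
`e_V(Q) ≤ E(N)/N + ε` (repeat an `ε`-minimiser of `E(N)` — a genuine infimum by stability — with a
large cubic period; the cross-cell interaction per particle tends to `0` by the tail bound, and is
even `≤ 0` for large periods since a one-crossing mixture with a negative value is eventually
non-positive). Not a consequence of the crux; true; provable now (class-1 analogue of
`ChargedEnergyGapNegative.energyPerParticle_periodise_le`). -/
theorem stub_periodisationLowerBound : ∀ V : ℝ → ℝ, (Literature.MathematicalPhysics.StatisticalMechanics.IsOneCrossingMixture V ∧ Filter.Tendsto V (nhdsWithin 0 (Set.Ioi 0)) Filter.atTop ∧ (∃ r : ℝ, 0 < r ∧ V r < 0) ∧ (∃ C ε : ℝ, 0 < ε ∧ ∀ r : ℝ, 1 ≤ r → |V r| ≤ C * r ^ (-(3 + ε))) ∧ (∃ B : ℝ, ∀ (N : ℕ) (x : Fin N → EuclideanSpace ℝ (Fin 3)), Function.Injective x → -(B * (N : ℝ)) ≤ Literature.MathematicalPhysics.StatisticalMechanics.interactionEnergy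 V x)) → ∀ N : ℕ, 1 ≤ N → ∀ ε : ℝ, 0 < ε → ∃ Q : Literature.MathematicalPhysics.StatisticalMechanics.PeriodicConfiguration 3, Q.energyPerParticle V ≤ Literature.MathematicalPhysics.StatisticalMechanics.groundStateEnergy V 3 N / (N : ℝ) + ε := by
  sorry

/-- **Stub 3 — the periodic infimum is attained** (the open heart of the crux). For every class-1
potential `V` there is a periodic configuration `P` of `ℝ³` whose energy per particle is the least
value of `e_V` over all periodic configurations (class-1 analogue of the open shared item 0627
`CrysPeriodicMinAttained`; why it might fail: a devil's staircase of optimal periods for soft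
members of the class — unbounded complexity of minimising sequences). Strictly weaker than the
crux (no statement about `E(N)/N`). -/
theorem stub_periodicMinimumAttained : ∀ V : ℝ → ℝ, (Literature.MathematicalPhysics.StatisticalMechanics.IsOneCrossingMixture V ∧ Filter.Tendsto V (nhdsWithin 0 (Set.Ioi 0)) Filter.atTop ∧ (∃ r : ℝ, 0 < r ∧ V r < 0) ∧ (∃ C ε : ℝ, 0 < ε ∧ ∀ r : ℝ, 1 ≤ r → |V r| ≤ C * r ^ (-(3 + ε))) ∧ (∃ B : ℝ, ∀ (N : ℕ) (x : Fin N → EuclideanSpace ℝ (Fin 3)), Function.Injective x → -(B * (N : ℝ)) ≤ Literature.MathematicalPhysics.StatisticalMechanics.interactionEnergy V x)) → ∃ P : Literature.MathematicalPhysics.StatisticalMechanics.PeriodicConfiguration 3, IsLeast (Set.range fun Q : Literature.MathematicalPhysics.StatisticalMechanics.PeriodicConfiguration 3 => Q.energyPerParticle V) (P.energyPerParticle V) := by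
  sorry

/-- **Assembly**: stub 1 → stub 2 → stub 3 → the crux. Take the minimiser `P` of stub 3; then
`E(N)/N → e_V(P)`: for `ε > 0`, eventually `E(N)/N ≤ e_V(P) + ε/2` (stub 1 at `Q = P`), and for
every `N ≥ 1`, `e_V(P) ≤ e_V(Q_N) ≤ E(N)/N + ε/2` (stub 2 and `IsLeast`). Concludes the route decl
`OneCrossingRisingSea.ClassOneEnergy` by name; no `sorry`. -/
theorem ClassOneEnergy_of : (∀ V : ℝ → ℝ, (Literature.MathematicalPhysics.StatisticalMechanics.IsOneCrossingMixture V ∧ Filter.Tendsto V (nhdsWithin 0 (Set.Ioi 0)) Filter.atTop ∧ (∃ r : ℝ, 0 < r ∧ V r < 0) ∧ (∃ C ε : ℝ, 0 < ε ∧ ∀ r : ℝ, 1 ≤ r → |V r| ≤ C * r ^ (-(3 + ε))) ∧ (∃ B : ℝ, ∀ (N : ℕ) (x : Fin N → EuclideanSpace ℝ (Fin 3)), Function.Injective x → -(B * (N : ℝ)) ≤ Literature.MathematicalPhysics.StatisticalMechanics.interactionEnergy V x)) → ∀ Q : Literature.MathematicalPhysics.StatisticalMechanics.PeriodicConfiguration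 3, ∀ ε : ℝ, 0 < ε → ∃ N₀ : ℕ, ∀ N : ℕ, N₀ ≤ N → Literature.MathematicalPhysics.StatisticalMechanics.groundStateEnergy V 3 N / (N : ℝ) ≤ Q.energyPerParticle V + ε) → (∀ V : ℝ → ℝ, (Literature.MathematicalPhysics.StatisticalMechanics.IsOneCrossingMixture V ∧ Filter.Tendsto V (nhdsWithin 0 (Set.Ioi 0)) Filter.atTop ∧ (∃ r : ℝ, 0 < r ∧ V r < 0) ∧ (∃ C ε : ℝ, 0 < ε ∧ ∀ r : ℝ, 1 ≤ r → |V r| ≤ C * r ^ (-(3 + ε))) ∧ (∃ B : ℝ, ∀ (N : ℕ) (x : Fin N → EuclideanSpace ℝ (Fin 3)), Function.Injective x → -(B * (N : ℝ)) ≤ Literature.MathematicalPhysics.StatisticalMechanics.interactionEnergy V x)) → ∀ N : ℕ, 1 ≤ N → ∀ ε : ℝ, 0 < ε → ∃ Q : Literature.MathematicalPhysics.StatisticalMechanics.PeriodicConfiguration 3, Q.energyPerParticle V ≤ Literature.MathematicalPhysics.StatisticalMechanics.groundStateEnergy V 3 N / (N : ℝ) + ε) → (∀ V : ℝ → ℝ,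 (Literature.MathematicalPhysics.StatisticalMechanics.IsOneCrossingMixture V ∧ Filter.Tendsto V (nhdsWithin 0 (Set.Ioi 0)) Filter.atTop ∧ (∃ r : ℝ, 0 < r ∧ V r < 0) ∧ (∃ C ε : ℝ, 0 < ε ∧ ∀ r : ℝ, 1 ≤ r → |V r| ≤ C * r ^ (-(3 + ε))) ∧ (∃ B : ℝ, ∀ (N : ℕ) (x : Fin N → EuclideanSpace ℝ (Fin 3)), Function.Injective x → -(B * (N : ℝ)) ≤ Literature.MathematicalPhysics.StatisticalMechanics.interactionEnergy V x)) → ∃ P : Literature.MathematicalPhysics.StatisticalMechanics.PeriodicConfiguration 3, IsLeast (Set.range fun Q : Literature.MathematicalPhysics.StatisticalMechanics.PeriodicConfiguration 3 => Q.energyPerParticle V) (P.energyPerParticle V)) → Summit.AtomisticToContinuum.Crystallization.Theses.OneCrossingRisingSea.ClassOneEnergy := by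
  intro hU hL hA V hV
  obtain ⟨P, hP⟩ := hA V hV
  refine ⟨P, hP, ?_⟩
  rw [Metric.tendsto_atTop]
  intro ε hε
  obtain ⟨N₀, hN₀⟩ := hU V hV P (ε / 2) (half_pos hε)
  refine ⟨max N₀ 1, fun N hN => ?_⟩
  have hN₀N : N₀ ≤ N := le_trans (le_max_left _ _) hN
  have hN1 : 1 ≤ N := le_trans (le_max_right _ _) hN
  obtain ⟨Q, hQ⟩ := hL V hV N hN1 (ε / 2) (half_pos hε)
  have hPQ : P.energyPerParticle V ≤ Q.energyPerParticle V := hP.2 ⟨Q, rfl⟩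
  have h1 := hN₀ N hN₀N
  rw [Real.dist_eq, abs_lt]
  constructor <;> linarith

/-- The assembly instantiated with the three stubs: the crux, modulo exactly the three `sorry`s
(by-name, hypothesis-free target of `ledger skeleton check`). -/
theorem ClassOneEnergy_proof : Summit.AtomisticToContinuum.Crystallization.Theses.OneCrossingRisingSea.ClassOneEnergy :=
  ClassOneEnergy_of stub_periodicTrialStateUpperBound stub_periodisationLowerBound stub_periodicMinimumAttained

end Summit.AtomisticToContinuum.Crystallization.Cruxes.ClassOneEnergy.Birth
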